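import Literature.NumberTheory.GaloisRepresentations.IdeleSUnitsLayerChaseArith
import Literature.NumberTheory.GaloisRepresentations.RestrictedRamificationCycCapLayers
import Literature.NumberTheory.GaloisRepresentations.SUnitsLayerInflation
import HarnessLib

/-!
# LAYER SUPPLY in degree `2`: every class of `H²(Gal(E/F₀), 𝒪_{E,S}ˣ)` becomes divisible by `p` in a bigger layer of `K_S`
# (Neukirch–Schmidt–Wingberg (8.3.11) (iii): `H²(G_S, 𝒪_S^×)(p)` is `p`-divisible — the finite-layer supply statement)

Topic `NumberTheory/GaloisRepresentations`; namespace `Literature.NumberTheory.GaloisRepresentations`.  THEOREMS ONLY (no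
definition, no named fact, no `sorry`, no instance).  Lane «PT3-TC» of cell `bsd-eis` (crux `GoodLatticeBDPValue`,
stmt-BirchSwinnertonDyer-19032; owner bsd-line-x1-p1-w8 g9, ROUTING #4: brick (A4-iii)), the statement consumed by the colimit
plumbing (A2-β2) / the assembly (A5) on the way to `cd_p(G_{K,S}) ≤ 2` / Harari Thm. 17.13 (a) at totally complex `K`.

MATHEMATICS (NSW VIII §3, proof of (8.3.11); Harari §17.4).  Let `K` be a totally complex number field, `S ⊇ S_p` a finite set of
finite places, `K_S = K̄^{N_S}`, and `F₀ ≤ E ⊆ K_S` intermediate fields of `K̄/K` with `E/K` finite Galois.  For a class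
`c ∈ H²(Gal(E/F₀), 𝒪_{E,S}ˣ)` there is a finite Galois layer `E′ ⊇ E` of `K_S` and `z ∈ H²(Gal(E′/F₀), 𝒪_{E′,S}ˣ)` with
`p · z = Inf c`.  Assembly of landed bricks: the tower `E ≤ E₁ ≤ E₂ ⊆ K_S` of `RestrictedRamificationCycCapLayers`
(`E₁ = E(ζ_{p^M})` with `p · n_v(E) ∣ n_v(E₁)` at the places `v` of `F₀` above `S` — width seat w5 g6's cyclotomic growth —,
`E₂` a capitulating layer — width seat w6 g8's principal ideal theorem placement); width seat w7 g8's finite-layer chase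
`IdeleCohomology.exists_smul_eq_sUnitsIdeleInf_sUnitsIdeleInf_two` (NSW (8.3.11) (iii) for the principal `S`-idèles, from the
class-formation facts and the local-invariant readout of `H²(G, J_{E,S})` — width seat w5 g6); and the transport to the `S`-unit
model `SUnits.sUnitsRep K S F₀ ·` of the lane (width seat w8 g9) through the natural isomorphism
`IdeleCohomology.sUnitsBridgeIso` and the `Hⁿ`-squares `sUnitsRepInf_comp_map_sUnitsBridge` (this seat's `SUnitsIdeleBridge`),
with the two inflation steps collapsed by `SUnits.Layers.layerInf_layerInf_apply`.

* §1 `isUnramifiedIn_of_le_of_ramificationSubgroup_le_galFixing` — a layer `E ⊆ K_S` is unramified over any `F₀ ≤ E` at the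
  places of `F₀` not above `S` (`e` is multiplicative in towers).
* §2 **`exists_layerInf_two_eq_nsmul`** — the LAYER SUPPLY statement (A4-iii), verbatim in the routed shape.

HONEST FRAMING: an assembly of landed theorems; it proves neither (H3μ) nor Harari 17.13 (a) nor any statement of a Summit; no
case of BSD is advanced by this file alone; 0 cells / labels / tiers move.

## References
* J. Neukirch, A. Schmidt, K. Wingberg, *Cohomology of Number Fields*, 2nd ed. (2008), VIII §3, (8.3.11) (iii) and its proof,
  (8.3.17)–(8.3.18). [NeukirchSchmidtWingberg2008]
* D. Harari, *Galois Cohomology and Class Field Theory*, Universitext, Springer (2020), §17.4 (17.1), Cor. 17.14, Prop. 15.40 (a).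
  [Harari2020]
* J. Neukirch, *Algebraic Number Theory* (1999), Ch. II §9 (multiplicativity of `e`). [NeukirchANT1999]
-/

noncomputable section

open NumberField IsDedekindDomain Field IntermediateField CategoryTheory groupCohomology
open Literature.NumberTheory.GaloisRepresentations.OpenSubgroupLayer (algOfLE isScalarTower_algOfLE)
open Literature.NumberTheory.GaloisRepresentations.LocalWeilDatum

namespace Literature.NumberTheory.GaloisRepresentations

variable {K : Type} [Field K] [NumberField K] (S : Set (HeightOneSpectrum (𝓞 K)))

/-! ## §1. A layer of `K_S` is unramified over every intermediate base at the places not above `S` -/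

/-- **`E ⊆ K_S` is unramified over `F₀ ≤ E` at every finite place `u` of `F₀` not above `S`** (for the inclusion algebra):
`E/K` is unramified at `v = u ∩ K ∉ S` (tree `isUnramifiedIn_of_ramificationSubgroup_le_galFixing`), and a prime of `E` above
`u` lies above `v`, so its ramification over `𝒪_{F₀}` divides its (trivial) ramification over `𝒪_K` (Mathlib
`Algebra.IsUnramifiedAt.of_restrictScalars`). [cite: NeukirchANT1999, Ch. II §9 (multiplicativity of `e` in towers)]
[cite: NeukirchSchmidtWingberg2008, VIII §3 (`K_S`)] -/
theorem isUnramifiedIn_of_le_of_ramificationSubgroup_le_galFixing {F₀ E : IntermediateField K (AlgebraicClosure K)}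
    [FiniteDimensional K E] [IsGalois K E] (hF : F₀ ≤ E) (hS : ramificationSubgroup K S ≤ galFixing K E)
    (u : HeightOneSpectrum (𝓞 F₀)) (hu : u.under (𝓞 K) ∉ S) :
    letI := algOfLE hF
    Algebra.IsUnramifiedIn (𝓞 E) u.asIdeal := by
  letI := algOfLE hF
  haveI := isScalarTower_algOfLE (K := K) hF
  haveI : NumberField E := NumberField.of_module_finite K E
  haveI : IsScalarTower (𝓞 K) (𝓞 F₀) (𝓞 E) := IsScalarTower.of_algebraMap_eq fun x => RingOfIntegers.ext rfl
  intro P hP hPu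
  haveI := hP
  haveI := hPu
  haveI : P.LiesOver (u.under (𝓞 K)).asIdeal := by
    rw [IsDedekindDomain.HeightOneSpectrum.under_asIdeal]
    haveI : u.asIdeal.LiesOver (u.asIdeal.under (𝓞 K)) := ⟨rfl⟩
    exact Ideal.LiesOver.trans P u.asIdeal (u.asIdeal.under (𝓞 K))
  haveI : Algebra.IsUnramifiedAt (𝓞 K) P :=
    isUnramifiedIn_of_ramificationSubgroup_le_galFixing (K := K) E hS hu P hP inferInstance
  exact Algebra.IsUnramifiedAt.of_restrictScalars (𝓞 K) P

/-! ## §2. The layer supply statement (A4-iii) -/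

/-- **LAYER SUPPLY, degree `2` (NSW (8.3.11) (iii) at finite layers, `S`-unit model).**  `K` totally complex, `S ⊇ S_p` finite,
`F₀ ≤ E ⊆ K_S` with `E/K` finite Galois.  For every `c ∈ H²(Gal(E/F₀), 𝒪_{E,S}ˣ)` there is a finite Galois layer `E′ ⊇ E` inside
`K_S` and `z ∈ H²(Gal(E′/F₀), 𝒪_{E′,S}ˣ)` with `p • z = Inf c` (all algebras = inclusions).  `E′ := E₂` of
`exists_cycCapLayers` (cyclotomic layer, then capitulating layer); the divisibility is w7 g8's
`IdeleCohomology.exists_smul_eq_sUnitsIdeleInf_sUnitsIdeleInf_two` for the principal `S₀`-idèles (`S₀` = the places of `F₀` above `S`),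
transported to `SUnits.sUnitsRep` through `IdeleCohomology.sUnitsBridgeIso` and `sUnitsRepInf_comp_map_sUnitsBridge`.
[cite: NeukirchSchmidtWingberg2008, VIII §3 (8.3.11) (iii) (proof)][cite: Harari2020, §17.4 (17.1), Prop. 15.40 (a)] -/
theorem exists_layerInf_two_eq_nsmul [IsTotallyComplex K] (hfin : S.Finite) (p : ℕ) [Fact p.Prime]
    (hSp : ∀ v : HeightOneSpectrum (𝓞 K), ((p : ℕ) : 𝓞 K) ∈ v.asIdeal → v ∈ S)
    {F₀ E : IntermediateField K (AlgebraicClosure K)} [FiniteDimensional K E] [IsGalois K E] (hF : F₀ ≤ E)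
    (hS : ramificationSubgroup K S ≤ galFixing K E)
    (c : letI := algOfLE hF; groupCohomology (SUnits.sUnitsRep K S F₀ E) 2) :
    ∃ (E' : IntermediateField K (AlgebraicClosure K)) (_ : FiniteDimensional K E') (_ : IsGalois K E') (hEE' : E ≤ E')
      (_ : ramificationSubgroup K S ≤ galFixing K E')
      (z : letI := algOfLE (hF.trans hEE'); groupCohomology (SUnits.sUnitsRep K S F₀ E') 2),
      p • z = SUnits.Layers.layerInf S hF hEE' 2 c := by
  classical
  -- the base `F₀`: finite over `K`, a totally complex number field
  letI := algOfLE hF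
  haveI := isScalarTower_algOfLE (K := K) hF
  haveI : FiniteDimensional K F₀ :=
    FiniteDimensional.of_injective (IntermediateField.inclusion hF).toLinearMap (IntermediateField.inclusion hF).injective
  haveI : NumberField F₀ := NumberField.of_module_finite K F₀
  haveI : NumberField E := NumberField.of_module_finite K E
  haveI : IsTotallyComplex F₀ := isTotallyComplex_of_algebra K F₀
  -- the places of `F₀` above `S`
  obtain ⟨S₀, hSF⟩ := exists_finset_mem_iff_under_mem S hfin F₀
  -- the tower `E ≤ E₁ ≤ E₂ ⊆ K_S`
  obtain ⟨E₁, h₁, hfin₁, hgal₁, E₂, h₂, hfin₂, hgal₂, hS₁, hS₂, hdeg, hcap⟩ := exists_cycCapLayers S p hSp hF hS S₀ 1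
  refine ⟨E₂, hfin₂, hgal₂, h₁.trans h₂, hS₂, ?_⟩
  -- instances along the tower over `F₀`
  letI := algOfLE h₁
  letI := algOfLE h₂
  letI := algOfLE (hF.trans h₁)
  letI := algOfLE (h₁.trans h₂)
  letI := algOfLE ((hF.trans h₁).trans h₂)
  haveI : NumberField E₁ := NumberField.of_module_finite K E₁
  haveI : NumberField E₂ := NumberField.of_module_finite K E₂
  haveI := isScalarTower_algOfLE (K := K) h₁
  haveI := isScalarTower_algOfLE (K := K) h₂
  haveI := isScalarTower_algOfLE (K := K) (hF.trans h₁)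
  haveI := isScalarTower_algOfLE (K := K) (h₁.trans h₂)
  haveI := isScalarTower_algOfLE (K := K) ((hF.trans h₁).trans h₂)
  haveI : IsScalarTower F₀ E E₁ := IsScalarTower.of_algebraMap_eq fun _ => rfl
  haveI : IsScalarTower F₀ E₁ E₂ := IsScalarTower.of_algebraMap_eq fun _ => rfl
  haveI : IsScalarTower F₀ E E₂ := IsScalarTower.of_algebraMap_eq fun _ => rfl
  haveI : IsScalarTower E E₁ E₂ := IsScalarTower.of_algebraMap_eq fun _ => rfl
  haveI : IsGalois F₀ E := IsGalois.tower_top_of_isGalois K F₀ E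
  haveI : IsGalois F₀ E₁ := IsGalois.tower_top_of_isGalois K F₀ E₁
  haveI : IsGalois F₀ E₂ := IsGalois.tower_top_of_isGalois K F₀ E₂
  -- `E`, `E₁` are unramified over `F₀` outside `S₀`; `p · n_v(E) ∣ n_v(E₁)` on `S₀`
  have hunr : ∀ v : HeightOneSpectrum (𝓞 F₀), v ∉ S₀ → Algebra.IsUnramifiedIn (𝓞 E) v.asIdeal :=
    fun v hv => isUnramifiedIn_of_le_of_ramificationSubgroup_le_galFixing S hF hS v fun h => hv ((hSF v).2 h)
  have hunr₁ : ∀ v : HeightOneSpectrum (𝓞 F₀), v ∉ S₀ → Algebra.IsUnramifiedIn (𝓞 E₁) v.asIdeal :=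
    fun v hv => isUnramifiedIn_of_le_of_ramificationSubgroup_le_galFixing S (hF.trans h₁) hS₁ v fun h => hv ((hSF v).2 h)
  have hdeg' : ∀ v ∈ S₀, p * IdeleCohomology.localDegree E v ∣ IdeleCohomology.localDegree E₁ v := by
    simpa only [pow_one] using hdeg
  -- the divisibility for the principal `S₀`-idèles (w7 g8's finite-layer chase), at `x = H²(bridge_E) c`
  have hp0 : p ≠ 0 := (Fact.out : p.Prime).ne_zero
  set x : groupCohomology (IdeleCohomology.sUnitsIdeleRep F₀ E S₀) 2 :=
    groupCohomology.map (MonoidHom.id _) (IdeleCohomology.sUnitsBridge (K := K) (E := E) S S₀ hSF) 2 c with hx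
  obtain ⟨z', hz'⟩ := IdeleCohomology.exists_smul_eq_sUnitsIdeleInf_sUnitsIdeleInf_two (F := F₀) (E := E) (E₁ := E₁)
    (E₂ := E₂) S₀ hunr hunr₁ hp0 hdeg' hcap x
  -- transport back through the bridge at `E₂`
  let β₂ := IdeleCohomology.sUnitsBridgeIso (K := K) (F := F₀) (E := E₂) S S₀ hSF
  refine ⟨groupCohomology.map (MonoidHom.id _) β₂.inv 2 z', ?_⟩
  -- the two inflation steps, and the `Hⁿ` squares of the bridge
  rw [← SUnits.Layers.layerInf_layerInf_apply S hF h₁ h₂ 2 c, SUnits.Layers.layerInf_eq_sUnitsRepInf,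
    SUnits.Layers.layerInf_eq_sUnitsRepInf]
  have sq₁ := congrArg (fun φ => φ c)
    (IdeleCohomology.sUnitsRepInf_comp_map_sUnitsBridge (K := K) (F := F₀) (E := E) (E' := E₁) S S₀ hSF 2)
  have sq₂ := congrArg (fun φ => φ (IdeleCohomology.sUnitsRepInf (K := K) (F := F₀) (E := E) (E' := E₁) S 2 c))
    (IdeleCohomology.sUnitsRepInf_comp_map_sUnitsBridge (K := K) (F := F₀) (E := E₁) (E' := E₂) S S₀ hSF 2)
  simp only [ModuleCat.hom_comp, LinearMap.coe_comp, Function.comp_apply] at sq₁ sq₂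
  -- `(p:ℤ) • z' = H²(bridge_{E₂}) (Inf Inf c)`
  have hz'' : (p : ℤ) • z' = groupCohomology.map (MonoidHom.id _) β₂.hom 2
      (IdeleCohomology.sUnitsRepInf (K := K) (F := F₀) (E := E₁) (E' := E₂) S 2
        (IdeleCohomology.sUnitsRepInf (K := K) (F := F₀) (E := E) (E' := E₁) S 2 c)) := by
    rw [hz', hx, ← sq₁, ← sq₂]
    rfl
  -- apply `H²(bridge_{E₂}⁻¹)`
  have hinv : ∀ w : groupCohomology (SUnits.sUnitsRep K S F₀ E₂) 2,
      groupCohomology.map (MonoidHom.id _) β₂.inv 2 (groupCohomology.map (MonoidHom.id _) β₂.hom 2 w) = w := by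
    intro w
    change ((groupCohomology.functor ℤ _ 2).map β₂.hom ≫ (groupCohomology.functor ℤ _ 2).map β₂.inv) w = w
    rw [← CategoryTheory.Functor.map_comp, Iso.hom_inv_id, CategoryTheory.Functor.map_id]
    rfl
  rw [← natCast_zsmul, ← map_zsmul, hz'', hinv]

end Literature.NumberTheory.GaloisRepresentations

end
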